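import Summits.QuantumFields.BalabanUV.Beta.FP.RelInvPeriodisedCombTorusLetters
import Summits.QuantumFields.BalabanUV.Beta.FP.TorusSymGaugeCovariance
import Summits.QuantumFields.BalabanUV.Beta.FP.PeriodisedWardOrderZero

/-!
# `BalabanUV.Beta.FP.NestedColumnCombMultiplier` — road «FP» (binder row D1), ROUTE T, the OWNER d1-p3 g25's located question Q-FP-25-1
# (CLAIMS l.50010) ANSWERED BY A THEOREM: **THE COMB MULTIPLIER OF THE NESTED CHART IS IDENTICALLY DEAD AT THE LEVEL-0 TORUS LITERAL** —
# for EVERY datum `w`, the `τ₁`-component of the multiplier of `h := minOp H₀ [Q₁₀; τ₁]·w` vanishes, so the KKT row reads `H₀·h = Q₁₀ᵀ·λ` with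
# NO `τ₁ᵀ·μ` term ((K1)'s shape of my O-6 `PeriodisedWardOrderOneCompanion.torus_a1_total_of_kkt_rows`)

HONEST DEPENDENCY (page 1, mandatory): continuum YM on T⁴ ⇐ BetaPertH ∧ nine spine estimates (0/9 proved); BetaPertH ⇐ (D1) ∧ (D4) ∧ CAP+tail;
G-an2-4 gates asym, D1 and NE2/3/4.  HONEST FRAMING (cell contract, verbatim): «discharging `BetaPertH` makes Bałaban's UV stability UNCONDITIONAL —
a real constructive-QFT result; it is NOT the continuum limit and NOT the Clay problem.»  ABSOLUTE RULE (cell charter, verbatim): «No internally-minted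
statement may enter as a cited fact. Every hypothesis is either kernel-proved in this package or a verbatim quotation of a PUBLISHED theorem with page
reference. The manuscript(s) under audit are NOT citable for their own disputed steps — they are the thing under adjudication; programme-internal
(2001/route/tribunal) claims are never citable.»

WHY.  The OWNER (X3 on O-6, INFO-2 = Q-FP-25-1): for the NESTED column `h = minOp H₀ [Q₁₀; τ₁]·(v, 0)` the bordered system's KKT row is
`H₀·h = −Q₁₀ᵀ·λ − τ₁ᵀ·μ` with a COMB multiplier `μ` on the fine residual gauge parameters, while (K1) as typed carries no `τ₁ᵀ·μ` term — does `μ`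
vanish, or must (Δ2) display it?  ANSWER: `μ ≡ 0`, by three covariances the tree already holds BY NAME.  Dot the KKT row with a residual fine gauge
mode `D₁ s` (`s` a non-root site of the centred comb): `(D₁ s)ᵀ·H₀ = 0` (the ff block of the literal is the torus `δd`, which kills exact 1-forms:
`PeriodisedWardOrderZero.torus_H₀_mul_tgrad` + `RelInvPeriodisedCombTorusLetters.torus_H₀_transpose_comb`), `Q₁₀·D₁ s = 0` (the (0.4)-shifted averaging
rows kill the non-root gradients: `TorusSymGaugeCovariance.torus_sym_cov₁`), hence `(τ₁·D₁)ᵀ·μ = 0`; and `τ₁·D₁` (comb rows against residual gradients) is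
UNIMODULAR (`NestedStepLawTorusInstance.torus_uni₁`), so `μ = 0`.  No convexity, no estimate.

WHAT ([folklore] linear algebra BY NAME; no `def`, no `def … : Prop`, nothing cited, 0 sorry).
* §1 ABSTRACT (any finite index types over `ℝ`): `comb_multiplier_eq_zero` (`H₀ᵀ·D = 0`, `Q·D = 0`, `det (τ·D) ≠ 0`, `H₀·h + Qᵀ·λ + τᵀ·μ = 0 ⟹ μ = 0`);
  `effForm_mulVec_inr_eq_zero` (with `IsUnit (kkt H₀ [Q; τ]).det`: `(effForm H₀ [Q; τ]·w)∘inr = 0` for EVERY `w` — the effective form has NO comb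
  row); `kkt_row_minOp` (`H₀·(minOp H₀ [Q; τ]·w) = Qᵀ·((effForm H₀ [Q; τ]·w)∘inl)` — (K1)'s shape).
* §2 AT U21's LEVEL-0 TORUS LITERAL (`NestedStepLawTorusTransportedRowsGradedLevelZeroSymULowClosedLamW2Q2`'s `hH₀ hQ₁₀ hτ₁` VERBATIM, `3 ↦ d`):
  `perF_bhKStepSh_zero_ff_eq_rooted` (the literal's ff block IS the rooted form block, any root), **`torus_comb_multiplier_dead`** and
  **`torus_nested_column_kkt_row`** — for EVERY datum `w` (in particular the nested column's `(v, 0)`).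
Discharges NO binder of row D1 and NO row of the door by itself (it settles which multipliers (K1) must carry: the averaging one only); 0 estimates;
0∕4 row-D1 binders (hW, hR, D1Tel, D1Rep); NOT (J-a) complete, NOT (T-ID), NOT SDF, NOT D1, NEVER «G-an2-4 closed», NOT BetaPertH, NOT continuum,
NOT Clay.  «not in print; our bookkeeping».
Unit `b2b-balaban-beta-d1-formalise-leaf-05` (gen 35), 2026-08-23; no existing file touched.
-/

noncomputable section

namespace Summit.QuantumFields.BalabanUV.Beta.FP.NestedColumnCombMultiplier

open scoped BigOperators Matrix
open Matrix
open Literature.MathematicalPhysics.QuantumFieldTheory.Balaban1983to89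
open Literature.MathematicalPhysics.QuantumFieldTheory.Balaban1983to89.Beta
open Literature.MathematicalPhysics.QuantumFieldTheory.Balaban1983to89.Beta.Composition (kkt)
open Literature.MathematicalPhysics.QuantumFieldTheory.Balaban1983to89.Beta.CompositionSingular (effForm minOp kkt_mul_blocks)
open B5Prop11Plancherel (fine)
open B6Lemma24Torus (pbox)
open AffineAveraging (Site box toSite)
open AveragingContoursRooted (ctr ctrOff ctrOff_mem_box)
open OneStepResolventKernel (Fib)
open Summit.QuantumFields.BalabanUV.Beta.SymShiftedSpread (bhKStepSh bhKStepSh_zero)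
open Summit.QuantumFields.BalabanUV.Beta.DshAn1 (Dsh Dsh_inl_inl)
open Summit.QuantumFields.BalabanUV.Beta.BorderedHessian (bhK bhKAt bhKAt_inl_inl bhKStepAt bhKStepAt_zero)
open Summit.QuantumFields.BalabanUV.Beta.FP.KernelPeriodisationFib (Idx perF perF_apply perZ_apply)
open Summit.QuantumFields.BalabanUV.Beta.FP.TorusGaugeCovariance (tgrad)
open Summit.QuantumFields.BalabanUV.Beta.FP.TorusGaugeCovarianceCoarse (coarsePt)
open Summit.QuantumFields.BalabanUV.Beta.FP.TorusCombRows (Res combRowsT)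
open Summit.QuantumFields.BalabanUV.Beta.FP.NestedStepLawTorusInstance (dvd_fine torus_uni₁)
open Summit.QuantumFields.BalabanUV.Beta.FP.RelInvPeriodisedCombTorusLetters (torus_h1_comb torus_H₀_transpose_comb)
open Summit.QuantumFields.BalabanUV.Beta.FP.TorusSymGaugeCovariance (torus_sym_cov₁)
open Summit.QuantumFields.BalabanUV.Beta.FP.PeriodisedWardOrderZero (torus_H₀_mul_tgrad)

/-! ## §1 Abstract: a multiplier on rows whose gauge reading is unimodular dies when the form and the other rows are gauge-blind -/

section Abstract

variable {ν μ R : Type*} [Fintype ν] [Fintype μ] [Fintype R] [DecidableEq ν] [DecidableEq μ] [DecidableEq R]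

omit [DecidableEq ν] [DecidableEq μ] in
/-- [folklore] **THE COMB MULTIPLIER DIES**: if `H₀ᵀ·D = 0`, `Q·D = 0` and `det (τ·D) ≠ 0`, every solution of the KKT row
`H₀·h + Qᵀ·λ + τᵀ·μ = 0` has `μ = 0` (dot the row with the columns of `D`). -/
theorem comb_multiplier_eq_zero (H₀ : Matrix ν ν ℝ) (Q : Matrix μ ν ℝ) (τ : Matrix R ν ℝ) (D : Matrix ν R ℝ)
    (hH : H₀ᵀ * D = 0) (hQ : Q * D = 0) (hτ : (τ * D).det ≠ 0)
    {h : ν → ℝ} {lam : μ → ℝ} {mu : R → ℝ} (hkkt : H₀ *ᵥ h + Qᵀ *ᵥ lam + τᵀ *ᵥ mu = 0) : mu = 0 := by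
  have h1 : Dᵀ *ᵥ (H₀ *ᵥ h + Qᵀ *ᵥ lam + τᵀ *ᵥ mu) = 0 := by rw [hkkt, Matrix.mulVec_zero]
  have e1 : Dᵀ * H₀ = (H₀ᵀ * D)ᵀ := by rw [Matrix.transpose_mul, Matrix.transpose_transpose]
  have e2 : Dᵀ * Qᵀ = (Q * D)ᵀ := by rw [Matrix.transpose_mul]
  have e3 : Dᵀ * τᵀ = (τ * D)ᵀ := by rw [Matrix.transpose_mul]
  rw [Matrix.mulVec_add, Matrix.mulVec_add, Matrix.mulVec_mulVec, Matrix.mulVec_mulVec, Matrix.mulVec_mulVec, e1, e2, e3, hH, hQ,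
    Matrix.transpose_zero, Matrix.transpose_zero, Matrix.zero_mulVec, Matrix.zero_mulVec, zero_add, zero_add] at h1
  exact Matrix.eq_zero_of_mulVec_eq_zero (by rwa [Matrix.det_transpose]) h1

/-- [folklore] **THE EFFECTIVE FORM HAS NO COMB ROW**: under the same three covariances and `IsUnit (kkt H₀ [Q; τ]).det`, for EVERY datum `w`,
`(effForm H₀ [Q; τ]·w)∘inr = 0` — the `τ`-component of the multiplier of the minimiser `minOp H₀ [Q; τ]·w` (which is `−effForm·w`) vanishes. -/
theorem effForm_mulVec_inr_eq_zero (H₀ : Matrix ν ν ℝ) (Q : Matrix μ ν ℝ) (τ : Matrix R ν ℝ) (D : Matrix ν R ℝ)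
    (hH : H₀ᵀ * D = 0) (hQ : Q * D = 0) (hτ : (τ * D).det ≠ 0) (hdet : IsUnit (kkt H₀ (fromRows Q τ)).det) (w : μ ⊕ R → ℝ) :
    (effForm H₀ (fromRows Q τ) *ᵥ w) ∘ Sum.inr = 0 := by
  have hEL := (kkt_mul_blocks H₀ (fromRows Q τ) hdet).2.1
  have h1 : H₀ *ᵥ (minOp H₀ (fromRows Q τ) *ᵥ w) =
      Qᵀ *ᵥ ((effForm H₀ (fromRows Q τ) *ᵥ w) ∘ Sum.inl) + τᵀ *ᵥ ((effForm H₀ (fromRows Q τ) *ᵥ w) ∘ Sum.inr) := by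
    rw [Matrix.mulVec_mulVec, hEL, ← Matrix.mulVec_mulVec, Matrix.transpose_fromRows, Matrix.fromCols_mulVec]
  have h2 : H₀ *ᵥ (minOp H₀ (fromRows Q τ) *ᵥ w) + Qᵀ *ᵥ (-((effForm H₀ (fromRows Q τ) *ᵥ w) ∘ Sum.inl))
      + τᵀ *ᵥ (-((effForm H₀ (fromRows Q τ) *ᵥ w) ∘ Sum.inr)) = 0 := by
    rw [h1, Matrix.mulVec_neg, Matrix.mulVec_neg]
    abel
  have h3 := comb_multiplier_eq_zero H₀ Q τ D hH hQ hτ h2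
  rwa [neg_eq_zero] at h3

/-- [folklore] **(K1)'s SHAPE FOR EVERY MINIMISER COLUMN**: `H₀·(minOp H₀ [Q; τ]·w) = Qᵀ·((effForm H₀ [Q; τ]·w)∘inl)` — the KKT row carries the
`Q`-multiplier only. -/
theorem kkt_row_minOp (H₀ : Matrix ν ν ℝ) (Q : Matrix μ ν ℝ) (τ : Matrix R ν ℝ) (D : Matrix ν R ℝ)
    (hH : H₀ᵀ * D = 0) (hQ : Q * D = 0) (hτ : (τ * D).det ≠ 0) (hdet : IsUnit (kkt H₀ (fromRows Q τ)).det) (w : μ ⊕ R → ℝ) :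
    H₀ *ᵥ (minOp H₀ (fromRows Q τ) *ᵥ w) = Qᵀ *ᵥ ((effForm H₀ (fromRows Q τ) *ᵥ w) ∘ Sum.inl) := by
  rw [Matrix.mulVec_mulVec, (kkt_mul_blocks H₀ (fromRows Q τ) hdet).2.1, ← Matrix.mulVec_mulVec, Matrix.transpose_fromRows,
    Matrix.fromCols_mulVec, effForm_mulVec_inr_eq_zero H₀ Q τ D hH hQ hτ hdet w, Matrix.mulVec_zero, add_zero]

/-- [folklore] matrix form: the comb rows of the effective form vanish, `effForm H₀ [Q; τ] ∘ (inr, ·) = 0`. -/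
theorem effForm_submatrix_inr_eq_zero (H₀ : Matrix ν ν ℝ) (Q : Matrix μ ν ℝ) (τ : Matrix R ν ℝ) (D : Matrix ν R ℝ)
    (hH : H₀ᵀ * D = 0) (hQ : Q * D = 0) (hτ : (τ * D).det ≠ 0) (hdet : IsUnit (kkt H₀ (fromRows Q τ)).det) :
    (effForm H₀ (fromRows Q τ)).submatrix Sum.inr id = 0 := by
  ext r j
  have h := congrFun (effForm_mulVec_inr_eq_zero H₀ Q τ D hH hQ hτ hdet (Pi.single j 1)) r
  simp only [Function.comp_apply, Matrix.mulVec, dotProduct, Pi.single_apply, mul_ite, mul_one, mul_zero, Finset.sum_ite_eq',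
    Finset.mem_univ, if_true, Pi.zero_apply] at h
  rw [Matrix.submatrix_apply, Matrix.zero_apply]
  exact h

end Abstract

/-! ## §2 At U21's level-0 torus literal: the three covariances BY NAME, and the dead comb multiplier -/

section Torus

variable {d : ℕ} (M' : Fin (d + 1) → ℕ) [∀ μ, NeZero (M' μ)] (Lc : ℕ) [NeZero Lc]

omit [∀ μ, NeZero (M' μ)] in
/-- [folklore] **the literal's ff block IS the rooted form block** (any root `ρ`): `perF F (bhKStepSh d Lc (Dsh Lc) 0)∘(ff) = perF F (bhKStepAt d ρ Lc 0)∘(ff)`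
(`bhKStepSh_zero`, `Dsh_inl_inl`, `bhKStepAt_zero`, `bhKAt_inl_inl` — both are `bhK Lc` on (fields, fields)). -/
theorem perF_bhKStepSh_zero_ff_eq_rooted (ρ : Site (d + 1)) :
    (perF (fine Lc M') (bhKStepSh d Lc (Dsh Lc) 0)).submatrix
        (fun b : ↥(pbox (fine Lc M')) × Fin (d + 1) => ((b.1, Sum.inl b.2) : Idx (fine Lc M') (Fib d)))
        (fun b : ↥(pbox (fine Lc M')) × Fin (d + 1) => ((b.1, Sum.inl b.2) : Idx (fine Lc M') (Fib d)))
      = (perF (fine Lc M') (bhKStepAt d ρ Lc 0)).submatrix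
        (fun b : ↥(pbox (fine Lc M')) × Fin (d + 1) => ((b.1, Sum.inl b.2) : Idx (fine Lc M') (Fib d)))
        (fun b : ↥(pbox (fine Lc M')) × Fin (d + 1) => ((b.1, Sum.inl b.2) : Idx (fine Lc M') (Fib d))) := by
  ext p q
  simp only [Matrix.submatrix_apply, perF_apply, perZ_apply]
  refine tsum_congr fun m => ?_
  rw [bhKStepSh_zero, bhKStepAt_zero, bhKAt_inl_inl]
  show bhK Lc _ _ _ _ + Dsh Lc _ _ _ _ = _
  rw [Dsh_inl_inl, add_zero]

/-- **[folklore] `torus_comb_multiplier_dead` — Q-FP-25-1 ANSWERED**: at U21's level-0 torus literal (`hH₀ hQ₁₀ hτ₁` VERBATIM, `3 ↦ d`), for EVERY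
datum `w` on (coarse bonds) ⊕ (fine residual comb parameters), the comb component of the multiplier of the nested chart's minimiser vanishes:
`(effForm H₀ [Q₁₀; τ₁]·w)∘inr = 0`.  Ingredients BY NAME: `torus_H₀_transpose_comb` + `torus_H₀_mul_tgrad` (`H₀ᵀ·D₁ = 0`), `torus_sym_cov₁`
(`Q₁₀·D₁ = 0`), `torus_uni₁` (`|det(τ₁·D₁)| = 1`), `torus_h1_comb` (the sliced KKT is invertible). -/
theorem torus_comb_multiplier_dead
    {H₀ : Matrix (↥(pbox (fine Lc M')) × Fin (d + 1)) (↥(pbox (fine Lc M')) × Fin (d + 1)) ℝ}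
    (hH₀ : H₀ = (perF (fine Lc M') (bhKStepSh d Lc (Dsh Lc) 0)).submatrix
        (fun b : ↥(pbox (fine Lc M')) × Fin (d + 1) => ((b.1, Sum.inl b.2) : Idx (fine Lc M') (Fib d)))
        (fun b : ↥(pbox (fine Lc M')) × Fin (d + 1) => ((b.1, Sum.inl b.2) : Idx (fine Lc M') (Fib d))))
    {Q₁₀ : Matrix (↥(pbox M') × Fin (d + 1)) (↥(pbox (fine Lc M')) × Fin (d + 1)) ℝ}
    (hQ₁₀ : Q₁₀ = (perF (fine Lc M') (bhKStepSh d Lc (Dsh Lc) 0)).submatrix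
        (fun a : ↥(pbox M') × Fin (d + 1) => ((coarsePt M' Lc a.1, Sum.inr a.2) : Idx (fine Lc M') (Fib d)))
        (fun b : ↥(pbox (fine Lc M')) × Fin (d + 1) => ((b.1, Sum.inl b.2) : Idx (fine Lc M') (Fib d))))
    {τ₁ : Matrix (Res (ctr (d + 1) Lc) Lc (fine Lc M')) (↥(pbox (fine Lc M')) × Fin (d + 1)) ℝ}
    (hτ₁ : τ₁ = (combRowsT (ctr (d + 1) Lc) Lc (fine Lc M')).submatrix id
        (fun b : ↥(pbox (fine Lc M')) × Fin (d + 1) => ((b.1, Sum.inl b.2) : Idx (fine Lc M') (Fib d))))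
    (w : (↥(pbox M') × Fin (d + 1)) ⊕ Res (ctr (d + 1) Lc) Lc (fine Lc M') → ℝ) :
    (effForm H₀ (fromRows Q₁₀ τ₁) *ᵥ w) ∘ Sum.inr = 0 := by
  have hLc1 : 1 ≤ Lc := Nat.one_le_iff_ne_zero.mpr (NeZero.ne Lc)
  -- the residual fine gauge modes of the centred comb (U21's `hD₁`)
  set D₁ : Matrix (↥(pbox (fine Lc M')) × Fin (d + 1)) (Res (ctr (d + 1) Lc) Lc (fine Lc M')) ℝ :=
    (tgrad (fine Lc M')).submatrix (fun b : ↥(pbox (fine Lc M')) × Fin (d + 1) => ((b.1, Sum.inl b.2) : Idx (fine Lc M') (Fib d)))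
      (Subtype.val : Res (ctr (d + 1) Lc) Lc (fine Lc M') → ↥(pbox (fine Lc M'))) with hD₁
  have hdet : IsUnit (kkt H₀ (fromRows Q₁₀ τ₁)).det := by
    rw [hH₀, hQ₁₀, hτ₁]
    exact isUnit_iff_ne_zero.2 (torus_h1_comb M' 0)
  have hH : H₀ᵀ * D₁ = 0 := by
    rw [hH₀, torus_H₀_transpose_comb (fine Lc M') (dvd_fine M') 0, perF_bhKStepSh_zero_ff_eq_rooted M' Lc (toSite (ctrOff (d + 1) Lc))]
    exact torus_H₀_mul_tgrad M' (ctrOff_mem_box hLc1) 0 rfl _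
  have hQ : Q₁₀ * D₁ = 0 := by
    rw [hQ₁₀]
    exact torus_sym_cov₁ M' 0
  have hτ : (τ₁ * D₁).det ≠ 0 := by
    have h1 : |(τ₁ * D₁).det| = 1 := by
      rw [hτ₁]
      exact torus_uni₁ M' (ctrOff_mem_box hLc1)
    intro h0
    rw [h0, abs_zero] at h1
    exact zero_ne_one h1
  exact effForm_mulVec_inr_eq_zero H₀ Q₁₀ τ₁ D₁ hH hQ hτ hdet w

/-- **[folklore] `torus_nested_column_kkt_row`** — (K1)'s shape at U21's literal, for EVERY datum `w` (the nested column is `w := (v, 0)`):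
`H₀·(minOp H₀ [Q₁₀; τ₁]·w) = Q₁₀ᵀ·((effForm H₀ [Q₁₀; τ₁]·w)∘inl)` — the linearised-KKT residual of the nested chart's minimiser is an AVERAGING
multiplier only; the comb multiplier is dead (`torus_comb_multiplier_dead`), so (Δ2)'s (K1) needs no `τ₁ᵀ·μ` term. -/
theorem torus_nested_column_kkt_row
    {H₀ : Matrix (↥(pbox (fine Lc M')) × Fin (d + 1)) (↥(pbox (fine Lc M')) × Fin (d + 1)) ℝ}
    (hH₀ : H₀ = (perF (fine Lc M') (bhKStepSh d Lc (Dsh Lc) 0)).submatrix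
        (fun b : ↥(pbox (fine Lc M')) × Fin (d + 1) => ((b.1, Sum.inl b.2) : Idx (fine Lc M') (Fib d)))
        (fun b : ↥(pbox (fine Lc M')) × Fin (d + 1) => ((b.1, Sum.inl b.2) : Idx (fine Lc M') (Fib d))))
    {Q₁₀ : Matrix (↥(pbox M') × Fin (d + 1)) (↥(pbox (fine Lc M')) × Fin (d + 1)) ℝ}
    (hQ₁₀ : Q₁₀ = (perF (fine Lc M') (bhKStepSh d Lc (Dsh Lc) 0)).submatrix
        (fun a : ↥(pbox M') × Fin (d + 1) => ((coarsePt M' Lc a.1, Sum.inr a.2) : Idx (fine Lc M') (Fib d)))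
        (fun b : ↥(pbox (fine Lc M')) × Fin (d + 1) => ((b.1, Sum.inl b.2) : Idx (fine Lc M') (Fib d))))
    {τ₁ : Matrix (Res (ctr (d + 1) Lc) Lc (fine Lc M')) (↥(pbox (fine Lc M')) × Fin (d + 1)) ℝ}
    (hτ₁ : τ₁ = (combRowsT (ctr (d + 1) Lc) Lc (fine Lc M')).submatrix id
        (fun b : ↥(pbox (fine Lc M')) × Fin (d + 1) => ((b.1, Sum.inl b.2) : Idx (fine Lc M') (Fib d))))
    (w : (↥(pbox M') × Fin (d + 1)) ⊕ Res (ctr (d + 1) Lc) Lc (fine Lc M') → ℝ) :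
    H₀ *ᵥ (minOp H₀ (fromRows Q₁₀ τ₁) *ᵥ w) = Q₁₀ᵀ *ᵥ ((effForm H₀ (fromRows Q₁₀ τ₁) *ᵥ w) ∘ Sum.inl) := by
  have hdet : IsUnit (kkt H₀ (fromRows Q₁₀ τ₁)).det := by
    rw [hH₀, hQ₁₀, hτ₁]
    exact isUnit_iff_ne_zero.2 (torus_h1_comb M' 0)
  rw [Matrix.mulVec_mulVec, (kkt_mul_blocks H₀ (fromRows Q₁₀ τ₁) hdet).2.1, ← Matrix.mulVec_mulVec, Matrix.transpose_fromRows,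
    Matrix.fromCols_mulVec, torus_comb_multiplier_dead M' Lc hH₀ hQ₁₀ hτ₁ w, Matrix.mulVec_zero, add_zero]

end Torus

end Summit.QuantumFields.BalabanUV.Beta.FP.NestedColumnCombMultiplier

end
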